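import Summits.BirchSwinnertonDyer.BirchSwinnertonDyer.Theorems.CongruentShaFreeCutBDPUpToPowerMapIdentity
import Summits.BirchSwinnertonDyer.BirchSwinnertonDyer.Theorems.CongruentShaFreeCutPowerMapSeriesRigidity
import Summits.BirchSwinnertonDyer.BirchSwinnertonDyer.Theorems.CongruentShaFreeCutTwoAdicBDPTripleUpTo
import HarnessLib

set_option linter.dupNamespace false -- `Summit.BirchSwinnertonDyer.BirchSwinnertonDyer.Theorems.…` (summit = sub)
set_option autoImplicit false

/-!
# Route `CongruentShaFreeCut` (rung S2) — **LEMMA R∞ (series rigidity of the ♯-frame ACROSS PERIODS)**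
# and its reading for (LB-wan♯): the `∀`-tuple divisibility stub says no more than ONE tuple

Cell `bsd-cn100`, prover seat `bsd-cn100-transfer` (g11), plan g15 RULING-4 (2026-08-27T01:22:06Z)
«COMMISSIONED (transfer g11/g12 …): LEMMA R∞ (series rigidity across periods) in either of two typed shapes
— (R∞-a) … or (R∞-b) …», file 5 (assembly). Supports, does not close, stmt-BirchSwinnertonDyer-19079.
THEOREMS ONLY; imports no `Theses` module. PARTITION: none — RANK axis. HONEST FRAMING: implications from the
typed frame `IsBDPLFunctionUpTo`; nothing about any `L`-value or about (LB-wan♯) itself is asserted.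

* §1 `eq_zero_iff_of_isBDPLFunctionUpTo` — two ♯-frames of the same `(ι, 𝔭, κ, γ, f)` vanish together.
* §2 **`seriesRigidity_of_isBDPLFunctionUpTo` (R∞-a)**, any prime `p`: two ♯-frames
  `IsBDPLFunctionUpTo C ι 𝔭 κ γ f Ω_K Ω_p 𝓛`, `IsBDPLFunctionUpTo C' ι 𝔭 κ γ f Ω'_K Ω'_p 𝓛'` (`K` imaginary
  quadratic, `κ` anticyclotomic, `γ` a topological generator, `Ω_K, Ω'_K, Ω_p, Ω'_p, C, C' ≠ 0`) satisfy
  `p^a · 𝓛' = p^b · (w · 𝓛)` with `w ∈ R₀⟦T⟧ˣ` — i.e. `𝓛' ∈ Frac(R₀)ˣ · R₀⟦T⟧ˣ · 𝓛`. Proof: the power-type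
  functional equation (file 4, `powerMap_identity_of_isBDPLFunctionUpTo`) and its rigidity in `R₀⟦T⟧`
  (file 3, `exists_C_pow_mul_eq_of_powerMap_identity`).
* §3 `exists_pow_mul_mem_span_of_rel` — (R∞-b) bookkeeping: a `2^k`-divisibility into `(𝓛)` transfers to a
  `2^{k+b}`-divisibility into `(𝓛')`; **`twoAdicWanDivisibilityUpTo_of_frameDivisibility`** — the READING
  CENSUS: `TwoAdicWanDivisibilityUpTo` (the `∀`-tuple stub `stub_twoAdicWanDivisibilityUpTo` of lines v6cq /
  v6bq) follows from the same divisibility for ONE admissible tuple per datum. So the universal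
  quantification over `(Ω_K, Ω_p, C, 𝓛)` in (LB-wan♯) is HONEST: it costs exactly one tuple (plan g15
  RULING-4 OPTION (i) confirmed; no exotic admissible tuple can fail it while another satisfies it).

References: [Castella2018] Thm. 3.1; [Washington1997] §7.1–7.2; [CastellaGrossiLeeSkinner2022] Thm. 4.2.2
(shape of (LB-wan♯); nothing asserted).
-/

noncomputable section

open scoped Classical Topology

open Filter PowerSeries WeierstrassCurve NumberField IsDedekindDomain Field
  Literature.NumberTheory.EllipticCurves Literature.NumberTheory.EllipticCurves.ModularForms
  Literature.NumberTheory.QuadraticFields Literature.NumberTheory.EllipticCurves.Castella2018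
  Literature.NumberTheory.GaloisRepresentations Literature.NumberTheory.GaloisCohomology
open Summit.BirchSwinnertonDyer.Rank1Residual.X11b (unrSeries_eq_of_hasValueAt)
open Summit.BirchSwinnertonDyer.Rank1Residual.X11b.Halves (hasValueAt_zero_series)
open Summit.BirchSwinnertonDyer.BirchSwinnertonDyer.Theorems.CongruentShaFreeCutBDPUpToRigidity
  Summit.BirchSwinnertonDyer.BirchSwinnertonDyer.Theorems.CongruentShaFreeCutCharacterSupply
  Summit.BirchSwinnertonDyer.BirchSwinnertonDyer.Theorems.CongruentShaFreeCutBDPUpToPowerMapIdentity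
  Summit.BirchSwinnertonDyer.BirchSwinnertonDyer.Theorems.CongruentShaFreeCutPowerMapSeriesRigidity
  Summit.BirchSwinnertonDyer.BirchSwinnertonDyer.Theorems.CongruentShaFreeCutTwoAdicBDPTripleUpTo

namespace Summit.BirchSwinnertonDyer.BirchSwinnertonDyer.Theorems.CongruentShaFreeCutBDPUpToSeriesRigidity

variable {p : ℕ} [hp : Fact p.Prime]

section Frame

variable {K : Type} [Field K] [NumberField K] {N : ℕ} {ι : PadicAlgCl p ≃+* ℂ}
  {𝔭 : HeightOneSpectrum (𝓞 K)} {κ : ZpExtension K p} {γ : Field.absoluteGaloisGroup K}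
  {f : CuspForm (CongruenceSubgroup.Gamma0 N) 2} {ΩK ΩK' : ℂ} {Ωp Ωp' C C' : ℂ_[p]}
  {L L' : UnrSeries p}

/-! ### §1 Two ♯-frames vanish together -/

/-- If the first ♯-frame's series is `0` then so is the second's: the first frame's values
`C·ι⁻¹(value)·Ω_p^{4n}` all vanish, hence so do the second frame's values `(C'/C)·β^n` times them, along
the supplied characters accumulating at the trivial one; identity principle. [cite: Castella2018, Thm. 3.1] -/
theorem eq_zero_of_isBDPLFunctionUpTo_of_eq_zero (hK : IsImaginaryQuadratic K) (hκ : κ.IsAnticyclotomic)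
    (hγ : κ.IsTopGenerator γ) (hΩK : ΩK ≠ 0) (hΩK' : ΩK' ≠ 0) (hΩp : Ωp ≠ 0) (hC : C ≠ 0)
    (hL : IsBDPLFunctionUpTo C ι 𝔭 κ γ f ΩK Ωp L) (hL' : IsBDPLFunctionUpTo C' ι 𝔭 κ γ f ΩK' Ωp' L')
    (h0 : L = 0) : L' = 0 := by
  obtain ⟨m, x₀, φ, φ', r, r', hm, hx1, hx, hunr, hinf, hr, hrκ, hval, -, -, -, -, -⟩ :=
    characterSupplyAt (p := p) K ι κ γ hK hκ hγ
  have hT0 : Tendsto (fun k ↦ x₀ ^ p ^ k - 1) atTop (𝓝 0) := by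
    have := hx.sub_const 1
    simpa using this
  have hnpos : ∀ k, 0 < m * p ^ k := fun k ↦ Nat.mul_pos hm (pow_pos hp.out.pos _)
  refine unrSeries_eq_of_hasValueAt (v := fun _ ↦ 0) hT0
    (Frequently.of_forall fun k ↦ sub_ne_zero.mpr (hx1 k)) (fun k ↦ ?_)
    (fun k ↦ hasValueAt_zero_series _)
  -- the first frame's value at `φ_k` is `0`
  have h1 := hL.hasValueAt (hnpos k) (hunr _) (hinf _) (hr _) (hrκ _)
  rw [hval, h0] at h1
  have hV0 := (hasValueAt_zero_series (p := p) (x₀ ^ p ^ k - 1)).unique h1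
  -- the second frame's value is `(C'/C) β^n` times it
  have h2 := hasValueAt_frameUpTo_rescale hΩK hΩK' hΩp hC hL' (hnpos k) (hunr k) (hinf _) (hr _) (hrκ _)
  rw [hval, ← hV0, mul_zero] at h2
  exact h2

/-- **Two ♯-frames of the same `(ι, 𝔭, κ, γ, f)` vanish together.** [cite: Castella2018, Thm. 3.1] -/
theorem eq_zero_iff_of_isBDPLFunctionUpTo (hK : IsImaginaryQuadratic K) (hκ : κ.IsAnticyclotomic)
    (hγ : κ.IsTopGenerator γ) (hΩK : ΩK ≠ 0) (hΩK' : ΩK' ≠ 0) (hΩp : Ωp ≠ 0) (hΩp' : Ωp' ≠ 0)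
    (hC : C ≠ 0) (hC' : C' ≠ 0)
    (hL : IsBDPLFunctionUpTo C ι 𝔭 κ γ f ΩK Ωp L) (hL' : IsBDPLFunctionUpTo C' ι 𝔭 κ γ f ΩK' Ωp' L') :
    L = 0 ↔ L' = 0 :=
  ⟨eq_zero_of_isBDPLFunctionUpTo_of_eq_zero hK hκ hγ hΩK hΩK' hΩp hC hL hL',
    eq_zero_of_isBDPLFunctionUpTo_of_eq_zero hK hκ hγ hΩK' hΩK hΩp' hC' hL' hL⟩

/-! ### §2 LEMMA R∞ (R∞-a): series rigidity across periods -/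

/-- **LEMMA R∞ (series rigidity of the ♯-frame across periods and constants; plan g15 RULING-4 (R∞-a)),
any prime `p`.** Two ♯-frames `IsBDPLFunctionUpTo C ι 𝔭 κ γ f Ω_K Ω_p 𝓛` and
`IsBDPLFunctionUpTo C' ι 𝔭 κ γ f Ω'_K Ω'_p 𝓛'` of the SAME `(ι, 𝔭, κ, γ, f)` — `K` imaginary quadratic, `κ`
anticyclotomic, `γ` a topological generator, `Ω_K, Ω'_K, Ω_p, Ω'_p, C, C'` non-zero — satisfy
`p^a · 𝓛' = p^b · (w · 𝓛)` for some `a b : ℕ` and a UNIT `w` of `R₀⟦T⟧`; equivalently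
`𝓛' ∈ Frac(R₀)ˣ · R₀⟦T⟧ˣ · 𝓛`, so `𝓛` and `𝓛'` generate the same ideal of `R₀⟦T⟧ ⊗ ℚ`. Proof: both zero
(§1), or both non-zero and then the power-type functional equation
`(C'/C)^{p−1}·𝓛'(Φ)·𝓛^p = 𝓛'^p·𝓛(Φ)` (`powerMap_identity_of_isBDPLFunctionUpTo`) is rigid in `R₀⟦T⟧`
(`exists_C_pow_mul_eq_of_powerMap_identity`: Weierstrass preparation and a `p`-adic root descent).
[cite: Castella2018, Thm. 3.1 (arXiv:1704.06608 p. 9)] [cite: Washington1997, §7.1–7.2] -/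
theorem seriesRigidity_of_isBDPLFunctionUpTo (hK : IsImaginaryQuadratic K) (hκ : κ.IsAnticyclotomic)
    (hγ : κ.IsTopGenerator γ) (hΩK : ΩK ≠ 0) (hΩK' : ΩK' ≠ 0) (hΩp : Ωp ≠ 0) (hΩp' : Ωp' ≠ 0)
    (hC : C ≠ 0) (hC' : C' ≠ 0)
    (hL : IsBDPLFunctionUpTo C ι 𝔭 κ γ f ΩK Ωp L) (hL' : IsBDPLFunctionUpTo C' ι 𝔭 κ γ f ΩK' Ωp' L') :
    ∃ (a b : ℕ) (w : UnrSeries p), IsUnit w ∧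
      PowerSeries.C (((p : ℕ) : unrIntegers p) ^ a) * L' =
        PowerSeries.C (((p : ℕ) : unrIntegers p) ^ b) * (w * L) := by
  by_cases h0 : L = 0
  · have h0' : L' = 0 := (eq_zero_iff_of_isBDPLFunctionUpTo hK hκ hγ hΩK hΩK' hΩp hΩp' hC hC' hL hL').mp h0
    exact ⟨0, 0, 1, isUnit_one, by simp [h0, h0']⟩
  · have h0' : L' ≠ 0 := fun h ↦
      h0 ((eq_zero_iff_of_isBDPLFunctionUpTo hK hκ hγ hΩK hΩK' hΩp hΩp' hC hC' hL hL').mpr h)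
    exact exists_C_pow_mul_eq_of_powerMap_identity h0 h0'
      (powerMap_identity_of_isBDPLFunctionUpTo hK hκ hγ hΩK hΩK' hΩp hC hL hL')

end Frame

/-! ### §3 (R∞-b) the divisibility transfer, and the reading census for (LB-wan♯) -/

/-- **(R∞-b) bookkeeping.** If `c^a · 𝓛' = c^b · (w · 𝓛)` with `w` a unit, then a `c^k`-divisibility of a
family into `(𝓛)` is a `c^{k+b}`-divisibility into `(𝓛')`. [folklore] -/
theorem exists_pow_mul_mem_span_of_rel {R : Type*} [CommRing R] {c : R} {a b : ℕ} {L L' w : R⟦X⟧}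
    (hw : IsUnit w) (hrel : C (c ^ a) * L' = C (c ^ b) * (w * L)) {ι : Type*} {S : Set ι}
    {F : ι → R⟦X⟧} (h : ∃ k : ℕ, ∀ i ∈ S, C (c ^ k) * F i ∈ Ideal.span {L}) :
    ∃ k : ℕ, ∀ i ∈ S, C (c ^ k) * F i ∈ Ideal.span {L'} := by
  obtain ⟨k, hk⟩ := h
  obtain ⟨wi, hwi⟩ := hw.exists_right_inv
  refine ⟨k + b, fun i hi ↦ ?_⟩
  obtain ⟨q, hq⟩ := Ideal.mem_span_singleton'.mp (hk i hi)
  rw [Ideal.mem_span_singleton']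
  refine ⟨q * wi * C (c ^ a), ?_⟩
  calc q * wi * C (c ^ a) * L' = q * wi * (C (c ^ a) * L') := by ring
    _ = q * wi * (C (c ^ b) * (w * L)) := by rw [hrel]
    _ = C (c ^ b) * (q * L) * (w * wi) := by ring
    _ = C (c ^ (k + b)) * F i := by rw [hwi, mul_one, hq, pow_add, map_mul]; ring

/-- **READING CENSUS for (LB-wan♯) (plan g15 RULING-4: OPTION (i) confirmed by LEMMA R∞).** The `∀`-tuple
stub `TwoAdicWanDivisibilityUpTo` — for EVERY admissible `(Ω_K, Ω_p, C, 𝓛)` the divisibility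
`2^k · j_*(char_Λ 𝔛) ⊆ (𝓛)` — follows from the SAME divisibility for ONE admissible tuple per datum
`(n, ι', K, N, Dt, v, v̄, κ, γ)`: any two admissible series differ by `Frac(R₀)ˣ · R₀⟦T⟧ˣ`
(`seriesRigidity_of_isBDPLFunctionUpTo`), and the divisibility transfers (`exists_pow_mul_mem_span_of_rel`).
So the universal quantification over tuples in (LB-wan♯) is honest (costs one tuple), exactly as for
(LB-bdp♯) by LEMMA R. Nothing about (LB-wan♯) itself is asserted.
[cite: CastellaGrossiLeeSkinner2022, Thm. 4.2.2 (shape; nothing asserted)] [cite: Castella2018, Thm. 3.1] -/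
theorem twoAdicWanDivisibilityUpTo_of_frameDivisibility
    (h1 : ∀ ⦃n : ℕ⦄, Squarefree n →
      ∀ [(congruentNumberCurve n).IsElliptic] [(congruentNumberCurve n).IsGloballyMinimal]
        (ι' : PadicAlgCl 2 ≃+* ℂ) (K : Type) [Field K] [NumberField K] (N : ℕ) [NeZero N]
        (Dt : ModularParametrizationData (congruentNumberCurve n) N)
        (v vbar : HeightOneSpectrum (𝓞 K)) (κ : ZpExtension K 2) (γ : absoluteGaloisGroup K)
        [Fact (κ.IsTopGenerator γ)],
      (congruentNumberCurve n).conductorNorm ℤ = N → IsImaginaryQuadratic K →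
      SatisfiesHeegnerHypothesis N K → ((Ideal.span {(2 : ℤ)}).primesOver (𝓞 K)).ncard = 2 →
      (∀ (w : InfinitePlace K) (k : 𝓞 K), k ∈ v.asIdeal ↔ ‖ι'.symm (w.embedding (k : K))‖ < 1) →
      ((2 : ℕ) : 𝓞 K) ∈ vbar.asIdeal → vbar ≠ v → κ.IsAnticyclotomic →
      ∃ (ΩK : ℂ) (Ωp : (unrIntegers 2)ˣ) (C : ℂ_[2]) (L : UnrSeries 2),
        ΩK ≠ 0 ∧ C ≠ 0 ∧ IsBDPLFunctionUpTo C ι' v κ γ Dt.f ΩK ((Ωp : unrIntegers 2) : ℂ_[2]) L ∧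
        ∀ (j : ℤ_[2] →+* unrIntegers 2),
          (∀ x : ℤ_[2], ((j x : unrIntegers 2) : ℂ_[2]) = algebraMap ℚ_[2] ℂ_[2] (x : ℚ_[2])) →
          ∃ k : ℕ, ∀ F ∈ AcSelmer.XAc.charIdeal ((congruentNumberCurve n).baseChange K) 2 κ vbar ∅ γ,
            PowerSeries.C ((2 : unrIntegers 2) ^ k) * PowerSeries.map j F ∈ Ideal.span {L}) :
    TwoAdicWanDivisibilityUpTo := by
  intro n hsq _ _ ι' K _ _ N _ Dt v vbar κ γ hγ hN hK hHN hsplit hv hvbar hne hκ ΩK₁ Ωp₁ C₁ L₁ hΩK₁ hC₁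
    hL₁ j hj
  obtain ⟨ΩK₀, Ωp₀, C₀, L₀, hΩK₀, hC₀, hL₀, hdiv⟩ :=
    h1 hsq ι' K N Dt v vbar κ γ hN hK hHN hsplit hv hvbar hne hκ
  have hΩp₀ : ((Ωp₀ : unrIntegers 2) : ℂ_[2]) ≠ 0 := fun h ↦
    (Units.ne_zero Ωp₀) (Subtype.ext h)
  have hΩp₁ : ((Ωp₁ : unrIntegers 2) : ℂ_[2]) ≠ 0 := fun h ↦
    (Units.ne_zero Ωp₁) (Subtype.ext h)
  obtain ⟨a, b, w, hw, hrel⟩ := seriesRigidity_of_isBDPLFunctionUpTo hK hκ hγ.out hΩK₀ hΩK₁ hΩp₀ hΩp₁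
    hC₀ hC₁ hL₀ hL₁
  have h2 : ((2 : ℕ) : unrIntegers 2) = (2 : unrIntegers 2) := by norm_cast
  rw [h2] at hrel
  exact exists_pow_mul_mem_span_of_rel hw hrel (hdiv j hj)

end Summit.BirchSwinnertonDyer.BirchSwinnertonDyer.Theorems.CongruentShaFreeCutBDPUpToSeriesRigidity

end
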